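import Mathlib
import Literature.Analysis.Complex.TaylorCoefficientsAlgebra
import Literature.Analysis.Complex.DecomposableCauchyBound
import Literature.RingTheory.MvPowerSeries.LowestOrderIntegrality
import HarnessLib

/-!
# The Cauchy upper bound for the Calegari–Dimitrov–Tang auxiliary function (CDT §2.2, (2.7))

`Literature/Analysis/Complex/AuxiliaryCauchyUpperBound.lean`. Everything here is PROVED (no
definition, no named fact). This is the analytic half of the extrapolation step in the proof of
Lemma 2.0.4 of F. Calegari, V. Dimitrov, Y. Tang, *The unbounded denominators conjecture*
(J. Amer. Math. Soc. **38** (2025), 627–702; arXiv:2109.09040), §2.2, for the rational function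
`p(x) = x^N`. With the auxiliary function `F(x) = ∑_{i,k} a_{i,k} ∏_s (x_s^N)^{k_s} f_{i_s}(x_s)` of
Lemma 2.1.1 (shape (2.5)) and a holomorphic multiplier `h` on the closed unit disc with
`h(0) = 1`, CDT consider (display (2.4))

  `H(z) := h(z₁)^D ⋯ h(z_d)^D · F(φ(z₁), …, φ(z_d))`,

observe that "the normalizations `h(z) ∈ 1 + zℂ⟦z⟧` and `φ(z) ∈ φ'(0) z + z²ℂ⟦z⟧` exhibit
`c φ'(0)^β zⁿ` as a lowest order monomial in `H(z)`" (`c xⁿ` a lowest-order monomial of `F`,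
`|n| = β`), and bound this coefficient by Cauchy's formula on the unit polycircle (2.7),
`|c| · |φ'(0)|^β ≤ sup_{𝕋^d} |H|`, followed by the term-by-term estimate "Every such term is
bounded in magnitude on `𝕋^d` by `e^{κCα+o(α)} · max(sup_𝕋 |h|, sup_𝕋 |h · φ^*p|)^{dD} ·
max_i sup_𝕋 |φ^* f_i|^d`", each term being
`∏_j h(z_j)^{D−k_j} ∏_j (h(z_j) p(φ(z_j)))^{k_j} · f_{i_1}(φ(z_1)) ⋯ f_{i_d}(φ(z_d))`.

`norm_deriv_pow_mul_coeff_le` proves the resulting inequality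

  `|φ'(0)|^β · |[xⁿ] F| ≤ (∑_{i,k} |a_{i,k}|) · e^{dDM} · G^d`

(`e^M ≥ sup_𝕋 |h|, sup_𝕋 |h φ^N|`; `G ≥ sup_𝕋 |g_i|`, where `g_i` is the holomorphic function on
the closed disc with Taylor series `f_i(𝓣φ)`, i.e. `φ^* f_i`), entirely at the level of formal
power series in separated variables plus one-variable Cauchy estimates
(`Literature.Analysis.Complex.norm_sum_prod_taylorCoeff_le`): no function theory of several
complex variables is needed, because `H` is a finite sum of products of one-variable functions.

## References

* [CalegariDimitrovTang2025] F. Calegari, V. Dimitrov, Y. Tang, The unbounded denominators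
  conjecture, J. Amer. Math. Soc. 38 (2025), no. 3, 627–702, §2.2, (2.4)–(2.7) and the display
  after (2.7); arXiv:2109.09040.
-/

noncomputable section

open Metric Set Finset MvPowerSeries Finsupp
open Literature.RingTheory.MvPowerSeries

namespace Literature.Analysis.Complex

/-! ### 1. Formal preliminaries -/

section formal

variable {σ : Type*} [DecidableEq σ] {K : Type*} [CommRing K]

/-- The linear part of `x(t_s)` is `([t¹] x) · x_s`. [folklore] -/
theorem homogeneousComponent_one_toMvPowerSeries_eq (x : PowerSeries K) (s : σ) :
    homogeneousComponent 1 (x.toMvPowerSeries s : MvPowerSeries σ K) =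
      (PowerSeries.coeff 1 x) • X s := by
  ext d
  rw [coeff_homogeneousComponent, MvPowerSeries.coeff_smul, coeff_X, coeff_toMvPowerSeries]
  by_cases hd : d.degree = 1
  · rw [if_pos hd]
    by_cases hds : d = single s (d s)
    · have h1 : d s = 1 := by
        have h := hd
        rw [hds, degree_single] at h
        exact h
      rw [if_pos hds, h1, if_pos (by rw [← h1]; exact hds), mul_one]
    · rw [if_neg hds, if_neg, mul_zero]
      intro h
      apply hds
      rw [h, single_eq_same]
  · rw [if_neg hd, if_neg, mul_zero]
    intro h
    apply hd
    rw [h, degree_single]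

/-- The constant coefficient of `g(x_s)` is that of `g`. [folklore] -/
theorem constantCoeff_toMvPowerSeries_eq (g : PowerSeries K) (s : σ) :
    constantCoeff (g.toMvPowerSeries s : MvPowerSeries σ K) = PowerSeries.constantCoeff g := by
  rw [← coeff_zero_eq_constantCoeff_apply, coeff_toMvPowerSeries, if_pos (by simp),
    ← PowerSeries.coeff_zero_eq_constantCoeff_apply]
  rfl

omit [DecidableEq σ] in
/-- `∏_{s} λ^{e_s} = λ^{|e|}`. [folklore] -/
theorem prod_pow_eq_pow_degree (e : σ →₀ ℕ) (c : K) :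
    (e.prod fun _ n ↦ c ^ n) = c ^ e.degree := by
  rw [Finsupp.prod, Finset.prod_pow_eq_pow_sum, degree_apply]

end formal

/-- `[T¹] 𝓣u = u'(0)`. [folklore] -/
theorem coeff_one_taylorPowerSeries (u : ℂ → ℂ) :
    PowerSeries.coeff 1 (PowerSeries.mk fun n ↦ iteratedDeriv n u 0 / n.factorial) = deriv u 0 := by
  rw [PowerSeries.coeff_mk, iteratedDeriv_one, Nat.factorial_one, Nat.cast_one, div_one]

/-! ### 2. The Cauchy upper bound (2.7) with the term-by-term estimate -/

/-- **CDT §2.2, (2.7) and the display after it, for `p(x) = x^N`.** Let `h, φ` be holomorphic on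
a neighbourhood of the closed unit disc with `h(0) = 1`, `φ(0) = 0`, and `sup_𝕋 |h| ≤ e^M`,
`sup_𝕋 |h φ^N| ≤ e^M`; let `g₁, …, g_m` be holomorphic there with `sup_𝕋 |g_i| ≤ G`, and let
`f_i ∈ ℂ⟦x⟧` be formal power series with `f_i(𝓣φ) = 𝓣 g_i` (i.e. `φ^* f_i = g_i`). For complex
coefficients `a_{i,k}` (`i ∈ [m]^d`, `k ∈ [0,D)^d`) put
`F = ∑ a_{i,k} ∏_s (x_s^N)^{k_s} f_{i_s}(x_s)`, and let `n` be a multi-index of degree `β ≤ ord F`.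
Then `|φ'(0)|^β |[xⁿ] F| ≤ (∑ |a_{i,k}|) (e^{DM})^d G^d`: the `zⁿ`-coefficient of
`H = ∏_s h(z_s)^D · F(φ(z_s))_s` is `φ'(0)^β [xⁿ]F`, and is bounded through Cauchy's formula by
the sum over the `(mD)^d` terms `∏_s h(z_s)^{D−k_s} (h(z_s)φ(z_s)^N)^{k_s} g_{i_s}(z_s)` of their
suprema on the unit polycircle. [cite: CalegariDimitrovTang2025, §2.2, (2.4)–(2.7)] -/
theorem norm_deriv_pow_mul_coeff_le {m d D N : ℕ} {h φ : ℂ → ℂ}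
    (hh : AnalyticOnNhd ℂ h (closedBall 0 1)) (hφ : AnalyticOnNhd ℂ φ (closedBall 0 1))
    (hh0 : h 0 = 1) (hφ0 : φ 0 = 0) {M : ℝ}
    (hM1 : ∀ z ∈ sphere (0 : ℂ) 1, ‖h z‖ ≤ Real.exp M)
    (hM2 : ∀ z ∈ sphere (0 : ℂ) 1, ‖h z * φ z ^ N‖ ≤ Real.exp M)
    {g : Fin m → ℂ → ℂ} (hg : ∀ i, AnalyticOnNhd ℂ (g i) (closedBall 0 1)) {G : ℝ}
    (hG : ∀ i, ∀ z ∈ sphere (0 : ℂ) 1, ‖g i z‖ ≤ G)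
    (fC : Fin m → PowerSeries ℂ)
    (hfC : ∀ i, (fC i).subst (PowerSeries.mk fun n ↦ iteratedDeriv n φ 0 / n.factorial) =
      PowerSeries.mk fun n ↦ iteratedDeriv n (g i) 0 / n.factorial)
    (a : (Fin d → Fin m) × (Fin d → Fin D) → ℂ) {β : ℕ}
    (hβ : (β : ℕ∞) ≤ (∑ J, a J • ∏ s, (((PowerSeries.X ^ N) ^ (J.2 s : ℕ) * fC (J.1 s)
      ).toMvPowerSeries s : MvPowerSeries (Fin d) ℂ)).order)
    {n₀ : Fin d →₀ ℕ} (hn₀ : n₀.degree = β) :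
    ‖deriv φ 0‖ ^ β * ‖coeff n₀ (∑ J, a J • ∏ s, (((PowerSeries.X ^ N) ^ (J.2 s : ℕ) *
        fC (J.1 s)).toMvPowerSeries s : MvPowerSeries (Fin d) ℂ))‖ ≤
      (∑ J, ‖a J‖) * Real.exp (D * M) ^ d * G ^ d := by
  classical
  set Tφ : PowerSeries ℂ := PowerSeries.mk fun n ↦ iteratedDeriv n φ 0 / n.factorial with hTφ
  set Th : PowerSeries ℂ := PowerSeries.mk fun n ↦ iteratedDeriv n h 0 / n.factorial with hTh
  set F : MvPowerSeries (Fin d) ℂ := ∑ J, a J • ∏ s, (((PowerSeries.X ^ N) ^ (J.2 s : ℕ) *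
    fC (J.1 s)).toMvPowerSeries s : MvPowerSeries (Fin d) ℂ) with hF
  have hφ0' : AnalyticAt ℂ φ 0 := hφ 0 (mem_closedBall_self zero_le_one)
  have hh0' : AnalyticAt ℂ h 0 := hh 0 (mem_closedBall_self zero_le_one)
  have hg0' : ∀ i, AnalyticAt ℂ (g i) 0 := fun i ↦ hg i 0 (mem_closedBall_self zero_le_one)
  have hTφ0 : PowerSeries.constantCoeff Tφ = 0 := by
    rw [hTφ, constantCoeff_taylorPowerSeries, hφ0]
  have hTφ1 : PowerSeries.coeff 1 Tφ = deriv φ 0 := by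
    rw [hTφ]; exact coeff_one_taylorPowerSeries φ
  have hTh0 : PowerSeries.constantCoeff Th = 1 := by
    rw [hTh, constantCoeff_taylorPowerSeries, hh0]
  have hsφ : PowerSeries.HasSubst Tφ := PowerSeries.HasSubst.of_constantCoeff_zero' hTφ0
  -- the one-variable factors `u_{(i,k),s} = h^D · φ^{N k_s} · g_{i_s}` (as functions)
  set u : (Fin d → Fin m) × (Fin d → Fin D) → Fin d → ℂ → ℂ :=
    fun J s ↦ h ^ D * (φ ^ (N * (J.2 s : ℕ)) * g (J.1 s)) with hu
  -- their Taylor series are the formal factors of `H`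
  have hU : ∀ J : (Fin d → Fin m) × (Fin d → Fin D), ∀ s : Fin d,
      Th ^ D * PowerSeries.subst Tφ ((PowerSeries.X ^ N) ^ (J.2 s : ℕ) * fC (J.1 s)) =
        PowerSeries.mk (fun n ↦ iteratedDeriv n (u J s) 0 / n.factorial) := by
    intro J s
    rw [PowerSeries.subst_mul hsφ, PowerSeries.subst_pow hsφ, PowerSeries.subst_pow hsφ,
      PowerSeries.subst_X hsφ, hfC, ← pow_mul, hu]
    dsimp only
    rw [taylorPowerSeries_mul (hh0'.pow D) ((hφ0'.pow _).mul (hg0' _)),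
      taylorPowerSeries_mul (hφ0'.pow _) (hg0' _), taylorPowerSeries_pow hh0',
      taylorPowerSeries_pow hφ0']
  -- `H = ∏_s h(z_s)^D · F(φ(z)) = ∑_J a_J ∏_s 𝓣(u_{J,s})(z_s)`
  have hHsum : (∏ s, ((Th ^ D).toMvPowerSeries s : MvPowerSeries (Fin d) ℂ)) *
      MvPowerSeries.subst (fun s ↦ (Tφ.toMvPowerSeries s : MvPowerSeries (Fin d) ℂ)) F =
      ∑ J, a J • ∏ s, ((PowerSeries.mk fun n ↦ iteratedDeriv n (u J s) 0 / n.factorial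
        ).toMvPowerSeries s : MvPowerSeries (Fin d) ℂ) := by
    rw [hF, subst_sum_smul_prod_toMvPowerSeries Finset.univ a
      (fun J s ↦ (PowerSeries.X ^ N) ^ (J.2 s : ℕ) * fC (J.1 s)) hTφ0, Finset.mul_sum]
    refine Finset.sum_congr rfl fun J _ ↦ ?_
    rw [mul_smul_comm, ← Finset.prod_mul_distrib]
    refine congrArg (a J • ·) (Finset.prod_congr rfl fun s _ ↦ ?_)
    rw [← map_mul, hU J s]
  -- the lowest-order coefficient of `H` is `φ'(0)^β [xⁿ] F`
  have hsub0 : ∀ s : Fin d,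
      constantCoeff ((Tφ.toMvPowerSeries s : MvPowerSeries (Fin d) ℂ)) = 0 := by
    intro s; rw [constantCoeff_toMvPowerSeries_eq, hTφ0]
  have hsub1 : ∀ s : Fin d, homogeneousComponent 1 (Tφ.toMvPowerSeries s : MvPowerSeries (Fin d) ℂ)
      = (deriv φ 0) • X s := by
    intro s; rw [homogeneousComponent_one_toMvPowerSeries_eq, hTφ1]
  have hordsub : (β : ℕ∞) ≤
      (MvPowerSeries.subst (fun s ↦ (Tφ.toMvPowerSeries s : MvPowerSeries (Fin d) ℂ)) F).order := by
    refine MvPowerSeries.nat_le_order fun e he ↦ ?_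
    exact coeff_subst_eq_zero_of_degree_lt hsub0 F (lt_of_lt_of_le (by exact_mod_cast he) hβ)
  have hunit : constantCoeff (∏ s, ((Th ^ D).toMvPowerSeries s : MvPowerSeries (Fin d) ℂ)) = 1 := by
    rw [map_prod]
    refine Finset.prod_eq_one fun s _ ↦ ?_
    rw [constantCoeff_toMvPowerSeries_eq, map_pow, hTh0, one_pow]
  have hcoeffH : coeff n₀ ((∏ s, ((Th ^ D).toMvPowerSeries s : MvPowerSeries (Fin d) ℂ)) *
      MvPowerSeries.subst (fun s ↦ (Tφ.toMvPowerSeries s : MvPowerSeries (Fin d) ℂ)) F) =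
      (deriv φ 0) ^ β * coeff n₀ F := by
    rw [coeff_mul_of_degree_eq_of_constantCoeff_eq_one hunit hordsub hn₀,
      coeff_subst_of_degree_eq hsub0 hsub1 F hβ hn₀, prod_pow_eq_pow_degree, hn₀]
  -- … and it is a sum of products of one-variable Taylor coefficients
  have hcoeffH' : coeff n₀ ((∏ s, ((Th ^ D).toMvPowerSeries s : MvPowerSeries (Fin d) ℂ)) *
      MvPowerSeries.subst (fun s ↦ (Tφ.toMvPowerSeries s : MvPowerSeries (Fin d) ℂ)) F) =
      ∑ J, a J * ∏ s, iteratedDeriv (n₀ s) (u J s) 0 / (n₀ s).factorial := by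
    rw [hHsum, coeff_sum_smul_prod_toMvPowerSeries]
    simp only [PowerSeries.coeff_mk]
  -- one-variable Cauchy estimates for the factors
  have hdiff : ∀ J : (Fin d → Fin m) × (Fin d → Fin D), ∀ s : Fin d,
      DiffContOnCl ℂ (u J s) (ball 0 1) := by
    intro J s
    have han : AnalyticOnNhd ℂ (u J s) (closedBall 0 1) := by
      rw [hu]
      exact (hh.pow D).mul ((hφ.pow _).mul (hg _))
    refine DifferentiableOn.diffContOnCl ?_
    rw [closure_ball 0 one_ne_zero]
    exact han.differentiableOn
  have hbound : ∀ J : (Fin d → Fin m) × (Fin d → Fin D), ∀ s : Fin d,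
      ∀ z ∈ sphere (0 : ℂ) 1, ‖u J s z‖ ≤ Real.exp (D * M) * G := by
    intro J s z hz
    have hk : (J.2 s : ℕ) ≤ D := (J.2 s).is_lt.le
    have hsplit : u J s z =
        h z ^ (D - (J.2 s : ℕ)) * (h z * φ z ^ N) ^ (J.2 s : ℕ) * g (J.1 s) z := by
      rw [hu]
      simp only [Pi.mul_apply, Pi.pow_apply]
      rw [← pow_sub_mul_pow (h z) hk, pow_mul]
      ring
    rw [hsplit, norm_mul, norm_mul, norm_pow, norm_pow, Real.exp_nat_mul,
      ← pow_sub_mul_pow (Real.exp M) hk]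
    have h1 : ‖h z‖ ^ (D - (J.2 s : ℕ)) ≤ Real.exp M ^ (D - (J.2 s : ℕ)) :=
      pow_le_pow_left₀ (norm_nonneg _) (hM1 z hz) _
    have h2 : ‖h z * φ z ^ N‖ ^ (J.2 s : ℕ) ≤ Real.exp M ^ (J.2 s : ℕ) :=
      pow_le_pow_left₀ (norm_nonneg _) (hM2 z hz) _
    have h3 : ‖g (J.1 s) z‖ ≤ G := hG _ z hz
    have he : 0 ≤ Real.exp M := (Real.exp_pos M).le
    exact mul_le_mul (mul_le_mul h1 h2 (by positivity) (by positivity)) h3 (norm_nonneg _)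
      (by positivity)
  have hW := norm_sum_prod_taylorCoeff_le Finset.univ a u (fun _ _ ↦ Real.exp (D * M) * G) n₀
    (fun J _ s ↦ hdiff J s) (fun J _ s z hz ↦ hbound J s z hz)
  -- combine
  calc ‖deriv φ 0‖ ^ β * ‖coeff n₀ F‖ = ‖(deriv φ 0) ^ β * coeff n₀ F‖ := by
        rw [norm_mul, norm_pow]
    _ = ‖∑ J, a J * ∏ s, iteratedDeriv (n₀ s) (u J s) 0 / (n₀ s).factorial‖ := by
        rw [← hcoeffH, hcoeffH']
    _ ≤ ∑ J, ‖a J‖ * ∏ _s : Fin d, (Real.exp (D * M) * G) := hW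
    _ = (∑ J, ‖a J‖) * Real.exp (D * M) ^ d * G ^ d := by
        rw [Finset.prod_const, Finset.card_univ, Fintype.card_fin, ← Finset.sum_mul, mul_pow,
          mul_assoc]

end Literature.Analysis.Complex
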